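import Mathlib
import Summits.Ventures.FusionMHD.Models.RwmFRS1
import Summits.Ventures.FusionMHD.Models.RwmFRS1Kq07
import Summits.Ventures.FusionMHD.Models.RwmFRS1Kq08Profile
import HarnessLib

/-!
# F3.r4 instance «RwmFRS1Kq08»: the external `(2,1)` kink / RESISTIVE WALL MODE of the exact force-balanced
# `q₀ = 4/5` screw pinch (`q_a = 8/5`) — MODEL, Newcomb's `f`, `g` in closed form, the marginal equation in
# certificate form, and the boundary form of `δW` (Freidberg (11.148))

LADDER-GRIDFUSION rung F3 (resistive / extended-MHD margins), row F3.r4 of `models/F3-SCOPING.md` (§2 R5 «cylindrical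
RWM, diffuse profile, no rotation: sign of `γ` and the rate `γτ_w = −δW_∞/δW_b`»; writer gridfusion-model-6, g8).  The second
`m = 2` member after row #109 «F3.r4-KINKEQ-RWM21» (`RwmFRS1Kq07*`, `q₀ = 7/10`, `q_a = 7/5`): here `q_a = 8/5`, closer to the
`q_a = 2` edge of the external `(2,1)` kink — the question this row answers is how much CLOSER the conducting wall must sit
(critical wall radius `b*`) and how much FASTER the thin-wall mode grows at a fixed wall, for the same family, one step up in `q_a`.

MODEL M_RWM,8 (MODELLED column; every hypothesis explicit): the `q₀ = 4/5` member of the cell's exact force-balanced screw-pinch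
FAMILY (rows #66 / #95 / #109: `Models/TearingFRS1EqIdealSigmaBoundR5` `EqSigmaR5.hl5`, `Models/KinkEqScrewPinchQ07` `KinkEqQ07.hlK`):
straight circular cylinder of periodicity length `2πR₀`, `μ₀ = 1`, `B_z ≡ 1`, `B_θ(r) = r c/(1+r²)` with `c = 1/(R₀q₀) = 1/4`
(`q(r) = rB_z/(R₀B_θ) = (4/5)(1 + r²)`, the ν = 1 SHAPE of HamEtAl2013 §4 `q = q₀(1 + λr²/r_a²)` [cite: HamEtAl2013, §4] with the
SYNTHETIC value `q₀ = 4/5`, DECLARED, said so in every sentence), the FORCE-BALANCE pressure `p = c²/(2(1+r²)²) − c²/8 + c²/400 =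
1/(32(1+r²)²) − 1/128 + 1/6400` (`Kq08.isRadialPressureBalance` PROVED in `RwmFRS1Kq08Profile.lean`: an EXACT ideal-MHD equilibrium [cite: Schnack2009, Lect. 30
eq. (30.30)], `β₀ = 2p(0) = 151/3200`), plasma radius `a = 1`, the DECLARED aspect-ratio choice `R₀ = 5a` so that `n = 1` is
`k = −n/R₀ = −1/5` (`RwmFRS1.kk`) — CONTINUED by a VACUUM region `a < r < b` and a thin resistive wall at `r = b`
[cite: Freidberg2014, §11.5.6].  CLASS C = the external helical mode `(m, n) = (2, 1)`: `q_a = 8/5 < 2`, so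
`F = k·B = (3 − 2r²)/(10(1+r²))` has NO zero in the plasma (`q = 2` only at `r² = 3/2 > a²`, in the vacuum): Newcomb's minimising
equation `(fξ′)′ = gξ` [cite: Freidberg2014, §11.5.1 eq. (11.97), §11.5.3 eq. (11.110)] is regular on `(0, a]` apart from the axis.
HONESTY: the internal `(1,1)` mode of this member (resonant at `q = 1`, `r² = 1/4`) is NOT treated here (for the `q₀ = 7/10` member it
is CERTIFIED UNSTABLE, row #95); the present row is about the external `(2,1)` mode only — juxtaposed, never merged, never «MHD
stable»; nothing about a device.  «MODELLED: absent effects = toroidicity (R₀ only through k), resistivity in the plasma, plasma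
rotation / kinetic damping (F3-SCOPING R7), finite wall thickness; MODEL-VALIDITY: MV-7R family strings.»

THIS FILE (no numerics; the equilibrium `P8` itself — `u8`, `p8`, force balance `isRadialPressureBalance`, regularity — is
`RwmFRS1Kq08Profile.lean`): the closed forms of `F`, `F†`, `f`, `f′`,
`g` for `(m,k) = (2, −1/5)` (`k₀²` is row #109's `Kq07.k0Sq_eq` BY NAME — same `m`, same `k`): `f = r³(3−2r²)²/(4(1+r²)²(r²+100))`,
`g = r·G_8(r²)/(100(1+r²)³(r²+100)²)` WITH the pressure term `2μ₀k²p′/k₀²`, `G_8(s) = (3−2s)(1+s)G_z(s) − 25s(s+100)`,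
`G_z(s) = (3−2s)(s+75)(s+100) − 50s(7+2s)`, `G_8 > 0` on `[0,1]`; the signs `f > 0`, `g > 0` on `(0, a]`, `F ≠ 0`; the marginal
equation as `P₂ξ″ + P₁ξ′ + P₀ξ = 0` with integer polynomial coefficients (`Kq08.rwmEq2p : LinearODE.Equation`) and the BRIDGE
`newcomb_of_isSolOn` to lit-4's form `HasDerivAt (f·ξ′) (g ξ)`; and the BOUNDARY FORM of the reference energies at `a = 1`
[cite: Freidberg2014, §11.5.6 eq. (11.148)–(11.149)]: `F_a = 1/20`, `F†_a = −9/20`, `k₀²(a) = 101/25`, hence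
`δŴ(Λ)/ξ_a² = (L − 9)/1616 + Λ/800` with `L = aξ′(a)/ξ(a)` (`Kq08.boundaryForm`, `boundaryForm_eq`), `Λ_crit(L) = 50(9 − L)/101`.
Companions: `RwmFRS1Kq08Axis*`, `RwmFRS1Kq08Chain`, `RwmFRS1Kq08Solution`, `RwmFRS1Kq08Energy`; generators
HOME/lean/tools/model-6/rwmgen/v4/. [instance data]
-/

noncomputable section

open Set Polynomial Literature.MathematicalPhysics.MHD Literature.Computation.Certificates
  Literature.Computation.Certificates.LinearODE

namespace Summit.Ventures.FusionMHD.Models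

namespace RwmFRS1

namespace Kq08

/-! ### Closed forms of `F`, `F†`, `k₀²`, `f`, `g` for `(m, k) = (2, −1/5)` -/

/-- `F = kB_z + mB_θ/r = (3 − 2r²)/(10(1+r²))` (`r ≠ 0`). [cite: Freidberg2014, §11.5.1 eq. (11.90)] -/
theorem kDotB_eq {r : ℝ} (hr : r ≠ 0) : P8.kDotB 2 kk r = (3 - 2 * r ^ 2) / (10 * (1 + r ^ 2)) := by
  have h1 : (0 : ℝ) < 1 + r ^ 2 := by positivity
  rw [ScrewPinch.Profile.kDotB, P8_Bθ, P8_Bz, kk]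
  field_simp
  ring

/-- `F† = kB_z − mB_θ/r = −(7 + 2r²)/(10(1+r²))` (`r ≠ 0`). [cite: Freidberg2014, §11.5.1 eq. (11.89)] -/
theorem kDotBDagger_eq {r : ℝ} (hr : r ≠ 0) : P8.kDotBDagger 2 kk r = -(7 + 2 * r ^ 2) / (10 * (1 + r ^ 2)) := by
  have h1 : (0 : ℝ) < 1 + r ^ 2 := by positivity
  rw [ScrewPinch.Profile.kDotBDagger, P8_Bθ, P8_Bz, kk]
  field_simp
  ring

/-- Newcomb's `f = rF²/k₀² = r³(3−2r²)²/(4(1+r²)²(r²+100))` (`r ≠ 0`). [cite: Freidberg2014, §11.5.1 eq. (11.90)] -/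
theorem newcombF_eq {r : ℝ} (hr : r ≠ 0) :
    P8.newcombF 2 kk r = r ^ 3 * (3 - 2 * r ^ 2) ^ 2 / (4 * (1 + r ^ 2) ^ 2 * (r ^ 2 + 100)) := by
  have h1 : (0 : ℝ) < 1 + r ^ 2 := by positivity
  have h2 : (0 : ℝ) < r ^ 2 + 100 := by positivity
  rw [ScrewPinch.Profile.newcombF, kDotB_eq hr, Kq07.k0Sq_eq hr]
  field_simp
  ring

/-- The zero-β cubic `G_z(s) = (3−2s)(s+75)(s+100) − 50s(7+2s) = 22500 − 14825s − 447s² − 2s³` (the current-driven part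
of the numerator of `g`). [instance data] -/
def Gz (s : ℝ) : ℝ := 22500 - 14825 * s - 447 * s ^ 2 - 2 * s ^ 3

/-- `G_z(s) = (3−2s)(s+75)(s+100) − 50s(7+2s)`. [instance data] -/
theorem Gz_eq (s : ℝ) : Gz s = (3 - 2 * s) * (s + 75) * (s + 100) - 50 * s * (7 + 2 * s) := by
  unfold Gz; ring

/-- `G_z ≥ 7226` on `[0, 1]` (decreasing; value at `s = 1`). [instance data] -/
theorem Gz_ge {s : ℝ} (h0 : 0 ≤ s) (h1 : s ≤ 1) : 7226 ≤ Gz s := by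
  unfold Gz
  have h2 : s ^ 2 ≤ 1 := by nlinarith
  have h3 : s ^ 3 ≤ 1 := by nlinarith
  nlinarith

/-- The quintic `G_8(s) = (3−2s)(1+s)G_z(s) − 25s(s+100) = 67500 − 24475s − 61191s² + 29197s³ + 892s⁴ + 4s⁵`
(numerator of `g` WITH the force-balance pressure term). [instance data] -/
def Gpoly (s : ℝ) : ℝ := 67500 - 24475 * s - 61191 * s ^ 2 + 29197 * s ^ 3 + 892 * s ^ 4 + 4 * s ^ 5

/-- `G_8(s) = (3−2s)(1+s)·G_z(s) − 25s(s+100)`. [instance data] -/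
theorem Gpoly_eq (s : ℝ) : Kq08.Gpoly s = (3 - 2 * s) * (1 + s) * Gz s - 25 * s * (s + 100) := by
  unfold Kq08.Gpoly Gz; ring

/-- `G_8 > 0` on `[0, 1]` (`(3−2s)(1+s)G_z(s) ≥ 2·7226 > 2525 ≥ 25s(s+100)` there). [instance data] -/
theorem Gpoly_pos {s : ℝ} (h0 : 0 ≤ s) (h1 : s ≤ 1) : 0 < Kq08.Gpoly s := by
  rw [Gpoly_eq]
  have hG := Gz_ge h0 h1
  have h12 : 2 ≤ (3 - 2 * s) * (1 + s) := by nlinarith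
  have hprod : 2 * 7226 ≤ (3 - 2 * s) * (1 + s) * Gz s := by
    have := mul_le_mul h12 hG (by norm_num) (by nlinarith)
    linarith
  nlinarith

/-- Newcomb's `g` (11.90) WITH the force-balance pressure: `g = r·G_8(r²)/(100(1+r²)³(r²+100)²)` (`r ≠ 0`).
[cite: Freidberg2014, §11.5.1 eq. (11.90)] -/
theorem newcombG_eq {r : ℝ} (hr : r ≠ 0) :
    P8.newcombG 2 kk r = r * Kq08.Gpoly (r ^ 2) / (100 * (1 + r ^ 2) ^ 3 * (r ^ 2 + 100) ^ 2) := by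
  have h1 : (0 : ℝ) < 1 + r ^ 2 := by positivity
  have h2 : (0 : ℝ) < r ^ 2 + 100 := by positivity
  rw [ScrewPinch.Profile.newcombG, deriv_p, kDotB_eq hr, kDotBDagger_eq hr, Kq07.k0Sq_eq hr, Kq08.Gpoly, kk, P8_μ₀]
  field_simp
  ring

/-- `F ≠ 0` on `0 < r`, `r² < 3/2` (no resonant surface of the `(2,1)` mode in the plasma: `q < 2`). [instance data] -/
theorem kDotB_ne_zero {r : ℝ} (hr : 0 < r) (h : r ^ 2 < 3 / 2) : P8.kDotB 2 kk r ≠ 0 := by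
  rw [kDotB_eq hr.ne']
  have h1 : (0 : ℝ) < 1 + r ^ 2 := by positivity
  exact div_ne_zero (by nlinarith) (by positivity)

/-- `F > 0` there. [instance data] -/
theorem kDotB_pos {r : ℝ} (hr : 0 < r) (h : r ^ 2 < 3 / 2) : 0 < P8.kDotB 2 kk r := by
  rw [kDotB_eq hr.ne']
  have h1 : (0 : ℝ) < 1 + r ^ 2 := by positivity
  exact div_pos (by nlinarith) (by positivity)

/-- `f > 0` on `0 < r`, `r² < 3/2`. [instance data] -/
theorem newcombF_pos {r : ℝ} (hr : 0 < r) (h : r ^ 2 < 3 / 2) : 0 < P8.newcombF 2 kk r := by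
  rw [newcombF_eq hr.ne']
  have h3 : (0 : ℝ) < (3 - 2 * r ^ 2) ^ 2 := by nlinarith
  positivity

/-- `g > 0` on the plasma `0 < r ≤ 1` (= a): the destabilising pressure term is dominated. [instance data] -/
theorem newcombG_pos {r : ℝ} (hr : 0 < r) (h : r ≤ 1) : 0 < P8.newcombG 2 kk r := by
  rw [newcombG_eq hr.ne']
  have hr2 : r ^ 2 ≤ 1 := by nlinarith
  have hG := Gpoly_pos (sq_nonneg r) hr2
  positivity

/-! ### The marginal equation in certificate form and the bridge to Newcomb's `(fξ′)′ = gξ` -/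

/-- Newcomb's marginal equation of MODEL M_RWM,8, mode `(2,1)`, cleared of denominators: `P₂ξ″ + P₁ξ′ + P₀ξ = 0` with
`P₂ = 25r²(3−2r²)²(1+r²)(r²+100)`, `P₁ = 25r(3−2r²)(900 − 1697r² − 619r⁴ − 2r⁶)`, `P₀ = −G_8(r²)` (coefficient lists,
low degree first; exact integers). [instance data] -/
def rwmEq2p : Equation :=
  ⟨[0, 0, 22500, 0, -7275, 0, -20075, 0, 9800, 0, 100], [0, 67500, 0, -172275, 0, 38425, 0, 30800, 0, 100],
    [-67500, 0, 24475, 0, 61191, 0, -29197, 0, -892, 0, -4]⟩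

/-- `P₂(r) = 25r²(3−2r²)²(1+r²)(r²+100)`. [instance data] -/
theorem eval_P2 (r : ℝ) :
    (toPolyR Kq08.rwmEq2p.P2).eval r = 25 * r ^ 2 * (3 - 2 * r ^ 2) ^ 2 * (1 + r ^ 2) * (r ^ 2 + 100) := by
  simp [Kq08.rwmEq2p, toPolyR, Finset.sum_range_succ]
  ring

/-- `P₁(r) = 25r(3−2r²)(900 − 1697r² − 619r⁴ − 2r⁶)`. [instance data] -/
theorem eval_P1 (r : ℝ) :
    (toPolyR Kq08.rwmEq2p.P1).eval r = 25 * r * (3 - 2 * r ^ 2) * (900 - 1697 * r ^ 2 - 619 * r ^ 4 - 2 * r ^ 6) := by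
  simp [Kq08.rwmEq2p, toPolyR, Finset.sum_range_succ]
  ring

/-- `P₀(r) = −G_8(r²)`. [instance data] -/
theorem eval_P0 (r : ℝ) : (toPolyR Kq08.rwmEq2p.P0).eval r = -Kq08.Gpoly (r ^ 2) := by
  rw [Kq08.Gpoly]
  simp [Kq08.rwmEq2p, toPolyR, Finset.sum_range_succ]
  ring

/-- `P₂ ≠ 0` on `0 < r`, `r² < 3/2`. [instance data] -/
theorem eval_P2_ne_zero {r : ℝ} (hr : 0 < r) (h : r ^ 2 < 3 / 2) : (toPolyR Kq08.rwmEq2p.P2).eval r ≠ 0 := by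
  rw [eval_P2]
  have h8 : (0 : ℝ) < (3 - 2 * r ^ 2) ^ 2 := by nlinarith
  positivity

/-- The solved-form coefficient `𝔭 = −P₁/P₂`. [instance data] -/
theorem pH_eq {r : ℝ} (hr : 0 < r) (h : r ^ 2 < 3 / 2) :
    Kq08.rwmEq2p.pH r = -(900 - 1697 * r ^ 2 - 619 * r ^ 4 - 2 * r ^ 6) /
      (r * (3 - 2 * r ^ 2) * (1 + r ^ 2) * (r ^ 2 + 100)) := by
  have h8 : (3 - 2 * r ^ 2 : ℝ) ≠ 0 := by nlinarith
  have h1 : (0 : ℝ) < 1 + r ^ 2 := by positivity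
  have h2 : (0 : ℝ) < r ^ 2 + 100 := by positivity
  have hr0 := hr.ne'
  rw [Equation.pH, eval_P1, eval_P2]
  field_simp

/-- The solved-form coefficient `𝔮 = −P₀/P₂ = g/f`. [instance data] -/
theorem qH_eq (r : ℝ) :
    Kq08.rwmEq2p.qH r = Kq08.Gpoly (r ^ 2) / (25 * r ^ 2 * (3 - 2 * r ^ 2) ^ 2 * (1 + r ^ 2) * (r ^ 2 + 100)) := by
  rw [Equation.qH, eval_P0, eval_P2]
  ring

/-- The derivative of `f`: `f′ = r²(3−2r²)(900 − 1697r² − 619r⁴ − 2r⁶)/(4(1+r²)³(r²+100)²)` on `0 < r`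
(so `P₁/P₂ = f′/f`). [instance data] -/
theorem hasDerivAt_newcombF {r : ℝ} (hr : 0 < r) :
    HasDerivAt (P8.newcombF 2 kk)
      (r ^ 2 * (3 - 2 * r ^ 2) * (900 - 1697 * r ^ 2 - 619 * r ^ 4 - 2 * r ^ 6) /
        (4 * (1 + r ^ 2) ^ 3 * (r ^ 2 + 100) ^ 2)) r := by
  have h1 : (0 : ℝ) < 1 + r ^ 2 := by positivity
  have h2 : (0 : ℝ) < r ^ 2 + 100 := by positivity
  have hev : (fun s => s ^ 3 * (3 - 2 * s ^ 2) ^ 2 / (4 * (1 + s ^ 2) ^ 2 * (s ^ 2 + 100))) =ᶠ[nhds r]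
      P8.newcombF 2 kk := by
    filter_upwards [isOpen_Ioi.mem_nhds hr] with s hs
    rw [newcombF_eq (ne_of_gt hs)]
  have hd : HasDerivAt (fun s : ℝ => s ^ 3 * (3 - 2 * s ^ 2) ^ 2 / (4 * (1 + s ^ 2) ^ 2 * (s ^ 2 + 100)))
      (((3 * r ^ 2 * (3 - 2 * r ^ 2) ^ 2 + r ^ 3 * (2 * (3 - 2 * r ^ 2) * (-(2 * (2 * r))))) *
          (4 * (1 + r ^ 2) ^ 2 * (r ^ 2 + 100)) -
        r ^ 3 * (3 - 2 * r ^ 2) ^ 2 * (4 * (2 * (1 + r ^ 2) * (2 * r)) * (r ^ 2 + 100) + 4 * (1 + r ^ 2) ^ 2 * (2 * r))) /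
        (4 * (1 + r ^ 2) ^ 2 * (r ^ 2 + 100)) ^ 2) r := by
    have hnum : HasDerivAt (fun s : ℝ => s ^ 3 * (3 - 2 * s ^ 2) ^ 2)
        (3 * r ^ 2 * (3 - 2 * r ^ 2) ^ 2 + r ^ 3 * (2 * (3 - 2 * r ^ 2) * (-(2 * (2 * r))))) r := by
      have ha := hasDerivAt_pow 3 r
      have hb : HasDerivAt (fun s : ℝ => 3 - 2 * s ^ 2) (-(2 * (2 * r))) r := by
        simpa using ((hasDerivAt_pow 2 r).const_mul 2).const_sub 3
      have hb2 := hb.pow 2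
      exact (ha.mul hb2).congr_deriv (by simp only [Pi.pow_apply]; push_cast; ring)
    have hden : HasDerivAt (fun s : ℝ => 4 * (1 + s ^ 2) ^ 2 * (s ^ 2 + 100))
        (4 * (2 * (1 + r ^ 2) * (2 * r)) * (r ^ 2 + 100) + 4 * (1 + r ^ 2) ^ 2 * (2 * r)) r := by
      have hc : HasDerivAt (fun s : ℝ => 1 + s ^ 2) (2 * r) r := by
        simpa using (hasDerivAt_pow 2 r).const_add 1
      have hc2 := (hc.pow 2).const_mul 4
      have he : HasDerivAt (fun s : ℝ => s ^ 2 + 100) (2 * r) r := by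
        simpa using (hasDerivAt_pow 2 r).add_const 100
      exact (hc2.mul he).congr_deriv (by simp only [Pi.pow_apply]; push_cast; ring)
    exact hnum.div hden (by positivity)
  refine (hd.congr_of_eventuallyEq hev.symm).congr_deriv ?_
  field_simp
  ring

/-- **BRIDGE.** A pair `(ξ, ξ′)` solving `Kq08.rwmEq2p` in the certificate sense on an OPEN set `s ⊆ {0 < r, r² < 3/2}`
(`ξ′ = dξ/dr`, `ξ″ = 𝔭ξ′ + 𝔮ξ`) satisfies Newcomb's marginal equation in lit-4's form there: `d/dr (f · deriv ξ) = g ξ`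
for MODEL M_RWM,8. [cite: Freidberg2014, §11.5.3 eq. (11.110)] -/
theorem newcomb_of_isSolOn {ξ ξ' : ℝ → ℝ} {s : Set ℝ} (hs : IsOpen s) (hsub : ∀ r ∈ s, 0 < r ∧ r ^ 2 < 3 / 2)
    (hsol : Kq08.rwmEq2p.IsSolOn ξ ξ' s) {r : ℝ} (hr : r ∈ s) :
    HasDerivAt (fun x => P8.newcombF 2 kk x * deriv ξ x) (P8.newcombG 2 kk r * ξ r) r := by
  obtain ⟨hr0, hr8⟩ := hsub r hr
  obtain ⟨h1, h2⟩ := hsol r hr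
  have hev : ξ' =ᶠ[nhds r] deriv ξ := by
    filter_upwards [hs.mem_nhds hr] with x hx
    exact ((hsol x hx).1.deriv).symm
  have h2' : HasDerivAt (deriv ξ) (Kq08.rwmEq2p.pH r * ξ' r + Kq08.rwmEq2p.qH r * ξ r) r :=
    h2.congr_of_eventuallyEq hev.symm
  have hf := hasDerivAt_newcombF hr0
  have hprod := hf.mul h2'
  refine hprod.congr_deriv ?_
  rw [h1.deriv, newcombF_eq hr0.ne', newcombG_eq hr0.ne', pH_eq hr0 hr8, qH_eq]
  have h8 : (3 - 2 * r ^ 2 : ℝ) ≠ 0 := by nlinarith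
  have h8b : (3 : ℝ) - r ^ 2 * 2 ≠ 0 := by nlinarith
  have h8sq : ((3 : ℝ) - 2 * r ^ 2) ^ 2 ≠ 0 := pow_ne_zero 2 h8
  have h1' : (0 : ℝ) < 1 + r ^ 2 := by positivity
  have h2'' : (0 : ℝ) < r ^ 2 + 100 := by positivity
  have hr0' := hr0.ne'
  field_simp
  ring

/-! ### The boundary form of the reference energies at `a = 1` (Freidberg (11.148)–(11.149)), `m = 2` -/

/-- Edge values: `F_a = 1/20`, `F†_a = −9/20`, `k₀²(a) = 101/25`, `f(a) = 1/1616`. [instance data] -/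
theorem edge_values : P8.kDotB 2 kk 1 = 1 / 20 ∧ P8.kDotBDagger 2 kk 1 = -9 / 20 ∧
    ScrewPinch.Profile.k0Sq 2 kk 1 = 101 / 25 ∧ P8.newcombF 2 kk 1 = 1 / 1616 := by
  refine ⟨?_, ?_, ?_, ?_⟩
  · rw [kDotB_eq one_ne_zero]; norm_num
  · rw [kDotBDagger_eq one_ne_zero]; norm_num
  · rw [Kq07.k0Sq_eq one_ne_zero]; norm_num
  · rw [newcombF_eq one_ne_zero]; norm_num

/-- THE BOUNDARY FORM of the reference energies per `ξ(a)²`, as a function of the logarithmic derivative `L = aξ′(a)/ξ(a)`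
of the marginal solution and the wall factor `Λ`: `δŴ(L, Λ) := (F²/k₀²) L + FF†/k₀² + a²F²Λ/m` at `a = 1`, `m = 2`, for
MODEL M_RWM,8. [cite: Freidberg2014, §11.5.6 eq. (11.148)–(11.149)] -/
def boundaryForm (L Λ : ℝ) : ℝ :=
  P8.kDotB 2 kk 1 ^ 2 / ScrewPinch.Profile.k0Sq 2 kk 1 * L +
    P8.kDotB 2 kk 1 * P8.kDotBDagger 2 kk 1 / ScrewPinch.Profile.k0Sq 2 kk 1 +
    1 ^ 2 * P8.kDotB 2 kk 1 ^ 2 * Λ / 2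

/-- **`δŴ(L, Λ) = (L − 9)/1616 + Λ/800`** (exact). [instance data] -/
theorem boundaryForm_eq (L Λ : ℝ) : Kq08.boundaryForm L Λ = (L - 9) / 1616 + Λ / 800 := by
  obtain ⟨e1, e2, e3, -⟩ := edge_values
  rw [Kq08.boundaryForm, e1, e2, e3]
  ring

/-- `δŴ` is the quantity of lit-4's `newcombExternalModes_iff` (its right-hand side is `δŴ(aξ₁′(a)/ξ₁(a), Λ)·ξ₁(a)²`
at `a = 1`, `m = 2`) for MODEL M_RWM,8. [cite: Freidberg2014, §11.5.3 eq. (11.118)] -/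
theorem boundaryForm_mul (ξ₁ : ℝ → ℝ) (Λ : ℝ) :
    (P8.kDotB 2 kk 1 ^ 2 / ScrewPinch.Profile.k0Sq 2 kk 1 * (1 * deriv ξ₁ 1 / ξ₁ 1) +
        P8.kDotB 2 kk 1 * P8.kDotBDagger 2 kk 1 / ScrewPinch.Profile.k0Sq 2 kk 1 +
        1 ^ 2 * P8.kDotB 2 kk 1 ^ 2 * Λ / 2) * ξ₁ 1 ^ 2 =
      Kq08.boundaryForm (1 * deriv ξ₁ 1 / ξ₁ 1) Λ * ξ₁ 1 ^ 2 := by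
  rw [Kq08.boundaryForm]

/-- `δŴ` is strictly increasing in `Λ` (slope `F_a²/2 = 1/800 > 0`): the wall can only help.
[cite: Freidberg2014, §11.5.6 eq. (11.150)] -/
theorem boundaryForm_strictMono (L : ℝ) : StrictMono (Kq08.boundaryForm L) := by
  intro x y hxy
  rw [boundaryForm_eq, boundaryForm_eq]
  linarith

/-- The critical wall factor at which `δŴ` changes sign: `Λ_crit(L) = 50(9 − L)/101`, i.e.
`δŴ(L, Λ) = (Λ − Λ_crit(L))/800`. [instance data] -/
def lambdaCrit (L : ℝ) : ℝ := 50 * (9 - L) / 101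

/-- `δŴ(L, Λ) = (Λ − Λ_crit)/800`. [instance data] -/
theorem boundaryForm_eq_sub (L Λ : ℝ) : Kq08.boundaryForm L Λ = (Λ - Kq08.lambdaCrit L) / 800 := by
  rw [boundaryForm_eq, Kq08.lambdaCrit]
  ring

/-- `δŴ > 0 ⟺ Λ > Λ_crit`. [instance data] -/
theorem boundaryForm_pos_iff (L Λ : ℝ) : 0 < Kq08.boundaryForm L Λ ↔ Kq08.lambdaCrit L < Λ := by
  rw [boundaryForm_eq_sub]
  constructor
  · intro h; by_contra hle; rw [not_lt] at hle
    have : (Λ - Kq08.lambdaCrit L) / 800 ≤ 0 := div_nonpos_of_nonpos_of_nonneg (by linarith) (by norm_num)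
    linarith
  · intro h; exact div_pos (by linarith) (by norm_num)

/-- `δŴ < 0 ⟺ Λ < Λ_crit`. [instance data] -/
theorem boundaryForm_neg_iff (L Λ : ℝ) : Kq08.boundaryForm L Λ < 0 ↔ Λ < Kq08.lambdaCrit L := by
  rw [boundaryForm_eq_sub]
  constructor
  · intro h; by_contra hle; rw [not_lt] at hle
    have : 0 ≤ (Λ - Kq08.lambdaCrit L) / 800 := div_nonneg (by linarith) (by norm_num)
    linarith
  · intro h; exact div_neg_of_neg_of_pos (by linarith) (by norm_num)

end Kq08

end RwmFRS1

end Summit.Ventures.FusionMHD.Models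

end
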